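import Literature.Probability.FitznerVanDerHofstad2017.Stage1Frame
import Literature.Probability.FitznerVanDerHofstad2017.EigenTails
import Literature.Probability.FitznerVanDerHofstad2017.BoundMapMonotone

/-!
# Literature.Probability.FitznerVanDerHofstad2017.Stage1Tails — the `N ≥ 4` tails of `Percolation.nb` (cells 32, 41, 42) without `Eigensystem`

CITATION HEADER (PLACEMENT v2). Part of the certified REPRODUCTION of R. Fitzner, R. van der Hofstad, *Mean-field
behavior for nearest-neighbor percolation in d > 10*, EJP 22 (2017) no. 43 [FvdH17] (notebook `Percolation.nb`,
transcript HOME/b2b-lace-num3/published/Percolation.txt) and *Generalized approach to the non-backtracking lace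
expansion*, PTRF 169 (2017) 1041–1119 [NoBLE17]; build `lace`, seat lean1 (gen 7), GAPS G8 layer L1′ step 1 /
MARGINS §9 (lemma E1 with its exact coefficients).  This module is ADDITIVE over `Stage1Cells`, `Stage1Frame`,
`EigenTails`, `BoundMapMonotone` (no declaration of those modules is changed), carries NO verdict and NO numeral of
the notebooks, and is programme-internal bookkeeping about the cited cells: NOT CITABLE as a fact about percolation.

WHAT THE CELLS SAY (transcript l.901–914 = cell 32, l.1131–1140 = cell 41, l.1152–1175 = cell 42, l.1184–1202 = cell 43;
`cell n` = the n-th `### [Input]` block, as in the LOCATORS paragraph of `Stage1Cells.lean`).  Cell 32 decomposes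
`P^S = Σ_j v_j`, `P^ι = Σ_j v^ι_j` along the eigenvectors of `Bᵀ` (`v_j.B = e_j v_j`) and `P^E = Σ_j v̄_j` along those of
`B̄` (`B̄.v̄_j = ē_j v̄_j`); cells 41–42 then write the `N ≥ 4` remainders of the bounds on `Ξ^{(N)}`, `Ξ^{ι,(N)}` and their
differences ([FvdH17] ext. version App. C, "we use these eigenvectors and the geometric sum", transcript l.1117–1129)
as closed forms `Σ_j g(e_j) v_j.X` with `g(e) = e³/(1−e²)`, `e³(2/(1−e²)² + 4/(1−e²))`, … .  Since
`Σ_j g(e_j) v_j = P^S.g(B)` and `Σ_j g(ē_j) v̄_j = g(B̄).P^E` for every power series `g`, each such cell is, without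
any eigen-decomposition, a series
`Σ_{a,b ≥ 0} ψ(a) χ(b) · uᵀ B^{α+2a} M B̄^{β+2b} w`                                                            (⋆)
with `ψ, χ ∈ {1, k ↦ k+1, k ↦ [k = 0]}` and entrywise non-negative ingredients `u ∈ {P^S, P^ι, h^S.A^{ιᵀ}, h^{ιι}}`,
`M ∈ {Ā^ι, 1, C₁, C₂, C₁B̄ + BC₂, C₂B̄ + BC₁}`, `w ∈ {P^E, H₃P^E + A^ι h^E, H₂P^E + A^ι h^E}` — all of them cells of
`Stage1Cells.lean` evaluated by `Stage1Frame.Data.ev` — and the four SUBTRACTED terms of cell 42 (`−4 P^S.C₁.P^E`,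
`−5 P^S.(C₁B̄+BC₂).P^E`, `−4 P^ι.B.C₂.P^E`, `−5 P^ι.B.C₂.P^E`) are exactly the `(a,b) = (0,0)` terms of the double
series they follow, so that every tail is a series of NON-NEGATIVE terms: it is monotone in every ingredient, it
converges exactly where the Neumann series of `B²` and `B̄²` do, and on that region it equals the notebook's closed
form (`Σ_a B^{2a} = (1−B²)⁻¹`, `Σ_a (a+1) B^{2a} = (1−B²)⁻²`).

WHAT IS PROVIDED.
* `neumannPartial`, `neumannPartialW` and the NEUMANN MAJORANT CERTIFICATE: for entrywise `0 ≤ A`, `0 ≤ S` with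
  `(1 − A) * S = 1` one has `Σ_{k<N} A^k = S − A^N S ≤ S` and `Σ_{k<N} (k+1) A^k = (Σ_{k<N} A^k) S − N A^N S ≤ S S`
  entrywise, hence `NeumannDom A`, `Σ_k A^k ≤ S`, `Σ_k (k+1) A^k ≤ S²` (`neumannPartial_apply_le`,
  `neumannPartialW_apply_le`, `neumannDom_of_inverse`, `tsum_pow_apply_le_of_inverse`, `summable_weighted_of_inverse`,
  `tsum_weighted_apply_le_of_inverse`).  No eigenvalue and no norm occurs: a rational candidate `S` is checked by
  `norm_num`, which is what a kernel instance needs.  (Sibling certificate: `EigenTails.neumannDom_of_superharmonic` of module `EigenTailsConv`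
  — `B v ≤ r v`, `r < 1` — gives `NeumannDom` with a GEOMETRIC majorant `v_i/((1−r) v_j)`; the exact-inverse form here
  is the one that loses nothing, `Σ_k A^k = S` on the nose, which the input-level margins require.)
* the series (⋆): `term`, `coef` (`drop = true` zeroes the `(0,0)` coefficient), `ser`, their non-negativity and
  MONOTONICITY in the ingredients (`ser_nonneg`, `ser_mono`; no convergence hypothesis — a divergent majorant has
  `tsum = 0 ≤ …` never to be USED, exactly as in `EigenTails`), the finite bilinear identity `sum_sum_term` and the
  CLOSED-FORM MAJORANTS `ser_le` / `ser_drop_le` under partial-sum bounds `Σ_{a<N} ψ(a) (B²)^a ≤ L`,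
  `Σ_{b<N} χ(b) (B̄²)^b ≤ R` (supplied by `cert_one`, `cert_lin`, `cert_delta` from the Neumann certificate); the three
  coefficient kinds `Kind.one | lin | delta` with their closed forms `Kind.L` (`S`, `S*S`, `1`), the two READINGS of a
  tail — `Reading.series` (the series (⋆)) and `Reading.closed S S̄` (the notebook's closed form with `(1−B²)⁻¹ ↦ S`,
  `(1−B̄²)⁻¹ ↦ S̄`) — and `Reading.series_leAt_closed : series ≤ closed S S̄` at non-negative ingredients under the two
  certificates `(1 − B²) S = 1`, `(1 − B̄²) S̄ = 1`, `0 ≤ S, S̄`.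
* cells 41–42 as DATA: `Piece` (coefficient, drop flag, the two kinds, the symbols of `u`, `M`, `w` and the extra
  powers `α`, `β`) and the ten tables `Tail.xiEven`, `Tail.xiOdd`, `Tail.xiIotaEven`, `Tail.xiIotaOdd`,
  `Tail.xiEvenDelta`, `Tail.xiOddDelta`, `Tail.xiIotaEvenDeltaEi`, `Tail.xiIotaOddDeltaEi`, `Tail.xiIotaEvenDeltaZero`,
  `Tail.xiIotaOddDeltaZero` — one `Piece` per printed summand, each table's docstring quoting its cell; `total Φ I l`
  evaluates a table in a reading `Φ` at an ingredient assignment `I : Ingr n` (`total_nonneg`, `total_mono`).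
  NAMES AS PRINTED: cells 41–42 use `Matrix[AiotabarNonRep,s]`, `Matrix[AiotaNonRep,s]` (`hS.Transpose[AiotaNonRep]`,
  `AiotaNonRep.hE`) and `Vector[PE,s]`, where cells 38–40 (`Stage1Cells.Xi2`, `Xi3`, `hSAt`, `H2PENTAhE`) use
  `AiotaBar`, `Aiota`, `PENT`; the tables transcribe what is printed (symbols `MSym.AbarNR`, `USym.hSAtNR`,
  `WSym.H3PEAhE`, `WSym.H2PEAhE`, cells `hSAtNR`, `H3PEAhE`, `H2PEAhE`, `C2BbarBC1` below).
* the instance over a typed frame `D : Stage1Frame.Data ν` at a state `y` and a point `s`: the ingredients as real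
  vectors / matrices (`evV`, `evM`, `ingr`, `ingr_nonneg` from `0 ≤ D.ev s y ·`, which `Stage1Frame.Std.ev_nonneg`
  supplies on the cone above the floor), the App. D input record WITH tails `inpFull D y s` (cell 44 as the notebook
  iterates it — cell 43: `Even = Ξ^{(0)} + EvenTail`, `Odd = Ξ^{(1)} + OddTail`, `Absolut = Even + Odd`, the tails
  CONTAINING the `N = 2, 3` terms; `Stage1Frame.Data.inp` is its tail-free truncation `T″₀`), the generic
  `inpT Φ` / `inp_dom_inpT` / `inpT_dom_inpT`, and the two order facts in the information order `Inputs.Dom` of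
  `BoundMapMonotone`: `inp_dom_inpFull : T″₀ ≤ T` (tails are `≥ 0`) and `inpFull_dom_inpMaj : T ≤ inpMaj S S̄`
  (the closed-form majorant record, field by field, under the two Neumann certificates at the point), composed in
  `inp_dom_inpMaj`.  With `BoundMapMonotone`'s monotonicity of `β ∘ inputs` this is the comparison STEP 2 of GAPS G8
  L1′ needs; STEP 2 itself (kernel evaluation of `inpMaj` at certified rational tables) is NOT in this module.

VALIDATION (Float, outside Lean; HOME/lean1-g7/validate): at `d = 11`, orders `(12,28)` and `(10,20)`, both points,
the ten tables in the reading `closed ((1−B²)⁻¹) ((1−B̄²)⁻¹)` agree with engine A's emulation of the notebook's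
`Eigensystem` cells 41–42 to relative `1.1e-13`, and the 22 tail-carrying fields of `inpFull` agree with the
notebook's own cell-43 aggregates to relative `1.1e-15`.

[cite: FitznerVanDerHofstad2017, notebook Percolation.nb cells 32, 41–44 (transcript l.901–914, l.1131–1202, l.1214–1237)]
[cite: DingZhou2009, §1.2 Theorem 1.2 (PDF p. 14)]
-/

noncomputable section

namespace Literature.Probability.FitznerVanDerHofstad2017
namespace Stage1Tails

open scoped Matrix
open Finset EigenTails

/-! ## The Neumann majorant certificate -/

section Neumann

variable {n : Type*} [Fintype n] [DecidableEq n]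

/-- `Σ_{k<N} A^k`. [folklore] -/
def neumannPartial (A : Matrix n n ℝ) (N : ℕ) : Matrix n n ℝ := ∑ k ∈ range N, A ^ k

/-- `Σ_{k<N} (k+1) A^k`. [folklore] -/
def neumannPartialW (A : Matrix n n ℝ) (N : ℕ) : Matrix n n ℝ := ∑ k ∈ range N, ((k : ℝ) + 1) • A ^ k

omit [Fintype n] [DecidableEq n] in
/-- entries of a finite sum of matrices. [folklore] -/
theorem sum_apply' {ι : Type*} (s : Finset ι) (g : ι → Matrix n n ℝ) (i j : n) :
    (∑ c ∈ s, g c) i j = ∑ c ∈ s, g c i j := Matrix.sum_apply i j s g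

/-- `(Σ_{k<N} A^k)(1 − A) = 1 − A^N`. [folklore] -/
theorem neumannPartial_mul_one_sub (A : Matrix n n ℝ) (N : ℕ) :
    neumannPartial A N * (1 - A) = 1 - A ^ N := geom_sum_mul_neg A N

/-- `(Σ_{k<N} (k+1) A^k)(1 − A) = Σ_{k<N} A^k − N A^N`. [folklore] -/
theorem neumannPartialW_mul_one_sub (A : Matrix n n ℝ) (N : ℕ) :
    neumannPartialW A N * (1 - A) = neumannPartial A N - (N : ℝ) • A ^ N := by
  induction N with
  | zero => simp [neumannPartialW, neumannPartial]
  | succ N ih =>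
    have h1 : neumannPartialW A (N + 1) = neumannPartialW A N + ((N : ℝ) + 1) • A ^ N := by
      simp [neumannPartialW, sum_range_succ]
    have h2 : neumannPartial A (N + 1) = neumannPartial A N + A ^ N := by
      simp [neumannPartial, sum_range_succ]
    rw [h1, add_mul, ih, h2, smul_mul_assoc, mul_sub, mul_one, ← pow_succ, smul_sub, add_smul, one_smul,
      Nat.cast_succ]
    abel

/-- With a right inverse `S` of `1 − A`: `Σ_{k<N} A^k = S − A^N S`. [folklore] -/
theorem neumannPartial_eq {A S : Matrix n n ℝ} (hS : (1 - A) * S = 1) (N : ℕ) :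
    neumannPartial A N = S - A ^ N * S := by
  have h : neumannPartial A N = neumannPartial A N * ((1 - A) * S) := by rw [hS, mul_one]
  rw [h, ← mul_assoc, neumannPartial_mul_one_sub, sub_mul, one_mul]

/-- With a right inverse `S` of `1 − A`: `Σ_{k<N} (k+1) A^k = (Σ_{k<N} A^k) S − N A^N S`. [folklore] -/
theorem neumannPartialW_eq {A S : Matrix n n ℝ} (hS : (1 - A) * S = 1) (N : ℕ) :
    neumannPartialW A N = neumannPartial A N * S - (N : ℝ) • (A ^ N * S) := by
  have h : neumannPartialW A N = neumannPartialW A N * ((1 - A) * S) := by rw [hS, mul_one]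
  rw [h, ← mul_assoc, neumannPartialW_mul_one_sub, sub_mul, smul_mul_assoc]

/-- entries of `Σ_{k<N} A^k` are `≥ 0` for `A ≥ 0`. [folklore] -/
theorem neumannPartial_apply_nonneg {A : Matrix n n ℝ} (hA : ∀ i j, 0 ≤ A i j) (N : ℕ) (i j : n) :
    0 ≤ neumannPartial A N i j := by
  rw [neumannPartial, sum_apply']
  exact sum_nonneg fun k _ => pow_apply_nonneg hA k i j

/-- NEUMANN MAJORANT, plain: `0 ≤ A`, `0 ≤ S`, `(1 − A) S = 1` ⇒ `Σ_{k<N} A^k ≤ S` entrywise. [folklore] -/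
theorem neumannPartial_apply_le {A S : Matrix n n ℝ} (hA : ∀ i j, 0 ≤ A i j) (hS0 : ∀ i j, 0 ≤ S i j)
    (hS : (1 - A) * S = 1) (N : ℕ) (i j : n) : neumannPartial A N i j ≤ S i j := by
  rw [neumannPartial_eq hS, Matrix.sub_apply]
  linarith [mul_apply_nonneg (pow_apply_nonneg hA N) hS0 i j]

/-- NEUMANN MAJORANT, weighted: `0 ≤ A`, `0 ≤ S`, `(1 − A) S = 1` ⇒ `Σ_{k<N} (k+1) A^k ≤ S S` entrywise. [folklore] -/
theorem neumannPartialW_apply_le {A S : Matrix n n ℝ} (hA : ∀ i j, 0 ≤ A i j) (hS0 : ∀ i j, 0 ≤ S i j)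
    (hS : (1 - A) * S = 1) (N : ℕ) (i j : n) : neumannPartialW A N i j ≤ (S * S) i j := by
  rw [neumannPartialW_eq hS, Matrix.sub_apply, Matrix.smul_apply, smul_eq_mul]
  have h1 : (neumannPartial A N * S) i j ≤ (S * S) i j :=
    mul_apply_mono (neumannPartial_apply_nonneg hA N) hS0 (neumannPartial_apply_le hA hS0 hS N) (fun _ _ => le_rfl) i j
  have h2 : 0 ≤ (N : ℝ) * (A ^ N * S) i j :=
    mul_nonneg (Nat.cast_nonneg N) (mul_apply_nonneg (pow_apply_nonneg hA N) hS0 i j)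
  linarith

/-- `Σ_{k<N} (A^k)_{ij} = (Σ_{k<N} A^k)_{ij}`. [folklore] -/
theorem sum_range_pow_apply (A : Matrix n n ℝ) (N : ℕ) (i j : n) :
    ∑ k ∈ range N, (A ^ k) i j = neumannPartial A N i j := by
  rw [neumannPartial, sum_apply']

/-- `Σ_{k<N} (k+1)(A^k)_{ij} = (Σ_{k<N} (k+1) A^k)_{ij}`. [folklore] -/
theorem sum_range_weighted_apply (A : Matrix n n ℝ) (N : ℕ) (i j : n) :
    ∑ k ∈ range N, ((k : ℝ) + 1) * (A ^ k) i j = neumannPartialW A N i j := by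
  rw [neumannPartialW, sum_apply']
  simp [Matrix.smul_apply]

/-- NEUMANN MAJORANT CERTIFICATE (convergence): `0 ≤ A`, `0 ≤ S`, `(1 − A) S = 1` ⇒ `A ∈ NeumannDom`
(for `A ≥ 0` this is `ρ(A) < 1`, [DingZhou2009] Thm. 1.2; here from bounded monotone partial sums, no spectrum).
[cite: DingZhou2009, §1.2 Theorem 1.2 (PDF p. 14)] -/
theorem neumannDom_of_inverse {A S : Matrix n n ℝ} (hA : ∀ i j, 0 ≤ A i j) (hS0 : ∀ i j, 0 ≤ S i j)
    (hS : (1 - A) * S = 1) : NeumannDom A := fun i j =>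
  summable_of_sum_range_le (fun k => pow_apply_nonneg hA k i j) fun N => by
    rw [sum_range_pow_apply]; exact neumannPartial_apply_le hA hS0 hS N i j

/-- … and `Σ_k A^k ≤ S` entrywise. [folklore] -/
theorem tsum_pow_apply_le_of_inverse {A S : Matrix n n ℝ} (hA : ∀ i j, 0 ≤ A i j) (hS0 : ∀ i j, 0 ≤ S i j)
    (hS : (1 - A) * S = 1) (i j : n) : ∑' k, (A ^ k) i j ≤ S i j :=
  Real.tsum_le_of_sum_range_le (fun k => pow_apply_nonneg hA k i j) fun N => by
    rw [sum_range_pow_apply]; exact neumannPartial_apply_le hA hS0 hS N i j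

/-- … and `Σ_k (k+1) A^k` converges entrywise. [folklore] -/
theorem summable_weighted_of_inverse {A S : Matrix n n ℝ} (hA : ∀ i j, 0 ≤ A i j) (hS0 : ∀ i j, 0 ≤ S i j)
    (hS : (1 - A) * S = 1) (i j : n) : Summable fun k : ℕ => ((k : ℝ) + 1) * (A ^ k) i j :=
  summable_of_sum_range_le (fun k => mul_nonneg (by positivity) (pow_apply_nonneg hA k i j)) fun N => by
    rw [sum_range_weighted_apply]; exact neumannPartialW_apply_le hA hS0 hS N i j

/-- … with `Σ_k (k+1) A^k ≤ S S` entrywise. [folklore] -/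
theorem tsum_weighted_apply_le_of_inverse {A S : Matrix n n ℝ} (hA : ∀ i j, 0 ≤ A i j) (hS0 : ∀ i j, 0 ≤ S i j)
    (hS : (1 - A) * S = 1) (i j : n) : ∑' k : ℕ, ((k : ℝ) + 1) * (A ^ k) i j ≤ (S * S) i j :=
  Real.tsum_le_of_sum_range_le (fun k => mul_nonneg (by positivity) (pow_apply_nonneg hA k i j)) fun N => by
    rw [sum_range_weighted_apply]; exact neumannPartialW_apply_le hA hS0 hS N i j

end Neumann

/-! ## The series `Σ_{a,b} ψ(a) χ(b) · uᵀ B^{α+2a} M B̄^{β+2b} w` -/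

section Series

variable {n : Type*} [Fintype n] [DecidableEq n]

/-- The `(a,b)` term `uᵀ B^α (B²)^a M (B̄²)^b B̄^β w` of the series (⋆) of the header.
[cite: FitznerVanDerHofstad2017, notebook Percolation.nb cells 41–42 (transcript l.1131–1175)] -/
def term (u : n → ℝ) (B : Matrix n n ℝ) (α : ℕ) (M : Matrix n n ℝ) (Bb : Matrix n n ℝ) (β : ℕ) (w : n → ℝ)
    (p : ℕ × ℕ) : ℝ :=
  u ⬝ᵥ ((B ^ α * (B * B) ^ p.1 * M * (Bb * Bb) ^ p.2 * Bb ^ β) *ᵥ w)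

/-- `c · term = tailTerm c u B^{α+2a} M B̄^{2b+β} w` (`EigenTails.tailTerm`). [folklore] -/
theorem mul_term_eq (c : ℝ) (u : n → ℝ) (B : Matrix n n ℝ) (α : ℕ) (M : Matrix n n ℝ) (Bb : Matrix n n ℝ)
    (β : ℕ) (w : n → ℝ) (p : ℕ × ℕ) :
    c * term u B α M Bb β w p = tailTerm c u B (α + 2 * p.1) M Bb (2 * p.2 + β) w := by
  simp only [term, tailTerm, pow_add, pow_mul, sq, Matrix.mul_assoc]

/-- The three coefficient kinds of cells 41–42: `1/(1−e²) = Σ_a e^{2a}` … [folklore] -/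
def kOne : ℕ → ℝ := fun _ => 1
/-- … `1/(1−e²)² = Σ_a (a+1) e^{2a}` … [folklore] -/
def kLin : ℕ → ℝ := fun a => (a : ℝ) + 1
/-- … and `1 = Σ_a [a = 0] e^{2a}` (a side on which no geometric sum is taken). [folklore] -/
def kDelta : ℕ → ℝ := fun a => if a = 0 then 1 else 0

/-- `kOne ≥ 0`. [folklore] -/
theorem kOne_nonneg (a : ℕ) : 0 ≤ kOne a := zero_le_one
/-- `kLin ≥ 0`. [folklore] -/
theorem kLin_nonneg (a : ℕ) : 0 ≤ kLin a := by unfold kLin; positivity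
/-- `kDelta ≥ 0`. [folklore] -/
theorem kDelta_nonneg (a : ℕ) : 0 ≤ kDelta a := by unfold kDelta; split_ifs <;> norm_num
/-- `kOne 0 = 1`. [folklore] -/
@[simp] theorem kOne_zero : kOne 0 = 1 := rfl
/-- `kLin 0 = 1`. [folklore] -/
@[simp] theorem kLin_zero : kLin 0 = 1 := by simp [kLin]
/-- `kDelta 0 = 1`. [folklore] -/
@[simp] theorem kDelta_zero : kDelta 0 = 1 := by simp [kDelta]

/-- The coefficient `ψ(a) χ(b)`, with the `(0,0)` one replaced by `0` when `drop` (the subtracted terms of cell 42).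
[cite: FitznerVanDerHofstad2017, notebook Percolation.nb cell 42 (transcript l.1161–1170)] -/
def coef (drop : Bool) (ψ χ : ℕ → ℝ) (p : ℕ × ℕ) : ℝ :=
  if drop ∧ p = (0, 0) then 0 else ψ p.1 * χ p.2

/-- the coefficients are `≥ 0`. [folklore] -/
theorem coef_nonneg {drop : Bool} {ψ χ : ℕ → ℝ} (hψ : ∀ a, 0 ≤ ψ a) (hχ : ∀ b, 0 ≤ χ b) (p : ℕ × ℕ) :
    0 ≤ coef drop ψ χ p := by
  unfold coef; split_ifs
  · exact le_rfl
  · exact mul_nonneg (hψ _) (hχ _)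

/-- undropped coefficient. [folklore] -/
theorem coef_false (ψ χ : ℕ → ℝ) (p : ℕ × ℕ) : coef false ψ χ p = ψ p.1 * χ p.2 := by simp [coef]

/-- coefficient off `(0,0)`. [folklore] -/
theorem coef_of_ne {drop : Bool} (ψ χ : ℕ → ℝ) {p : ℕ × ℕ} (hp : p ≠ (0, 0)) :
    coef drop ψ χ p = ψ p.1 * χ p.2 := by simp [coef, hp]

/-- dropped coefficient at `(0,0)`. [folklore] -/
theorem coef_true_zero (ψ χ : ℕ → ℝ) : coef true ψ χ (0, 0) = 0 := by simp [coef]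

/-- THE SERIES (⋆): `Σ_{(a,b)} coef(a,b) · uᵀ B^α (B²)^a M (B̄²)^b B̄^β w` over all `(a,b) ∈ ℕ²` (`drop = false`) or
over `(a,b) ≠ (0,0)` (`drop = true`).  A `tsum`: it is the notebook's closed form exactly on the convergence region
(`ser_le` gives the value of the bound there), and `0` off it.
[cite: FitznerVanDerHofstad2017, notebook Percolation.nb cells 41–42 (transcript l.1131–1175)] -/
def ser (drop : Bool) (ψ χ : ℕ → ℝ) (u : n → ℝ) (B : Matrix n n ℝ) (α : ℕ) (M : Matrix n n ℝ)
    (Bb : Matrix n n ℝ) (β : ℕ) (w : n → ℝ) : ℝ :=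
  ∑' p : ℕ × ℕ, coef drop ψ χ p * term u B α M Bb β w p

/-- Entrywise non-negativity of the five ingredients of (⋆). [folklore] -/
structure NN (u : n → ℝ) (B M Bb : Matrix n n ℝ) (w : n → ℝ) : Prop where
  u : ∀ i, 0 ≤ u i
  B : ∀ i j, 0 ≤ B i j
  M : ∀ i j, 0 ≤ M i j
  Bb : ∀ i j, 0 ≤ Bb i j
  w : ∀ i, 0 ≤ w i

/-- Entrywise `≤` of two ingredient tuples of (⋆). [folklore] -/
structure LE (u : n → ℝ) (B M Bb : Matrix n n ℝ) (w : n → ℝ) (u' : n → ℝ) (B' M' Bb' : Matrix n n ℝ) (w' : n → ℝ) :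
    Prop where
  u : ∀ i, u i ≤ u' i
  B : ∀ i j, B i j ≤ B' i j
  M : ∀ i j, M i j ≤ M' i j
  Bb : ∀ i j, Bb i j ≤ Bb' i j
  w : ∀ i, w i ≤ w' i

omit [Fintype n] [DecidableEq n] in
/-- `LE` is reflexive. [folklore] -/
theorem LE.rfl {u : n → ℝ} {B M Bb : Matrix n n ℝ} {w : n → ℝ} : LE u B M Bb w u B M Bb w :=
  ⟨fun _ => le_rfl, fun _ _ => le_rfl, fun _ _ => le_rfl, fun _ _ => le_rfl, fun _ => le_rfl⟩

variable {u u' : n → ℝ} {B B' M M' Bb Bb' : Matrix n n ℝ} {w w' : n → ℝ}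

/-- each weighted term is `≥ 0`. [folklore] -/
theorem mul_term_nonneg (h : NN u B M Bb w) {c : ℝ} (hc : 0 ≤ c) (α β : ℕ) (p : ℕ × ℕ) :
    0 ≤ c * term u B α M Bb β w p := by
  rw [mul_term_eq]; exact tailTerm_nonneg hc h.u h.B h.M h.Bb h.w _ _

/-- each weighted term is monotone in the ingredients. [folklore] -/
theorem mul_term_mono (h : NN u B M Bb w) (hle : LE u B M Bb w u' B' M' Bb' w') {c : ℝ} (hc : 0 ≤ c) (α β : ℕ)
    (p : ℕ × ℕ) : c * term u B α M Bb β w p ≤ c * term u' B' α M' Bb' β w' p := by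
  rw [mul_term_eq, mul_term_eq]
  exact tailTerm_mono hc h.u h.B h.M h.Bb h.w hle.u hle.B hle.M hle.Bb hle.w _ _

/-- `ser ≥ 0` (a `tsum` of non-negative terms; no summability needed). [folklore] -/
theorem ser_nonneg {drop : Bool} {ψ χ : ℕ → ℝ} (hψ : ∀ a, 0 ≤ ψ a) (hχ : ∀ b, 0 ≤ χ b) (h : NN u B M Bb w)
    (α β : ℕ) : 0 ≤ ser drop ψ χ u B α M Bb β w :=
  tsum_nonneg fun p => mul_term_nonneg h (coef_nonneg hψ hχ p) α β p

/-- MONOTONICITY of (⋆) in the ingredients: if the series converges for the larger (non-negative) ingredients it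
converges for the smaller ones and is `≤`. [folklore] -/
theorem ser_mono {drop : Bool} {ψ χ : ℕ → ℝ} (hψ : ∀ a, 0 ≤ ψ a) (hχ : ∀ b, 0 ≤ χ b) (h : NN u B M Bb w)
    (hle : LE u B M Bb w u' B' M' Bb' w') (α β : ℕ)
    (hs : Summable fun p => coef drop ψ χ p * term u' B' α M' Bb' β w' p) :
    Summable (fun p => coef drop ψ χ p * term u B α M Bb β w p) ∧
      ser drop ψ χ u B α M Bb β w ≤ ser drop ψ χ u' B' α M' Bb' β w' := by
  have hle' : ∀ p, coef drop ψ χ p * term u B α M Bb β w p ≤ coef drop ψ χ p * term u' B' α M' Bb' β w' p :=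
    fun p => mul_term_mono h hle (coef_nonneg hψ hχ p) α β p
  have hs' : Summable fun p => coef drop ψ χ p * term u B α M Bb β w p :=
    Summable.of_nonneg_of_le (fun p => mul_term_nonneg h (coef_nonneg hψ hχ p) α β p) hle' hs
  exact ⟨hs', hs'.tsum_le_tsum hle' hs⟩

/-- The linear functional `X ↦ uᵀ (L X R) w`. [folklore] -/
def sandwich (u : n → ℝ) (L R : Matrix n n ℝ) (w : n → ℝ) : Matrix n n ℝ →ₗ[ℝ] ℝ where
  toFun X := u ⬝ᵥ ((L * X * R) *ᵥ w)
  map_add' X Y := by simp only [Matrix.mul_add, Matrix.add_mul, Matrix.add_mulVec, dotProduct_add]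
  map_smul' c X := by
    simp only [Matrix.mul_smul, Matrix.smul_mul, Matrix.smul_mulVec, dotProduct_smul, smul_eq_mul,
      RingHom.id_apply]

omit [DecidableEq n] in
/-- `sandwich` unfolded. [folklore] -/
theorem sandwich_apply (u : n → ℝ) (L R X : Matrix n n ℝ) (w : n → ℝ) :
    sandwich u L R w X = u ⬝ᵥ ((L * X * R) *ᵥ w) := rfl

/-- `term` as a value of `sandwich`. [folklore] -/
theorem term_eq_sandwich (u : n → ℝ) (B : Matrix n n ℝ) (α : ℕ) (M : Matrix n n ℝ) (Bb : Matrix n n ℝ)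
    (β : ℕ) (w : n → ℝ) (p : ℕ × ℕ) :
    term u B α M Bb β w p = sandwich u (B ^ α) (Bb ^ β) w ((B * B) ^ p.1 * M * (Bb * Bb) ^ p.2) := by
  simp only [term, sandwich_apply, Matrix.mul_assoc]

/-- `(Σ_a ψ_a A^a) M (Σ_b χ_b C^b) = Σ_a Σ_b (ψ_a χ_b) · A^a M C^b`. [folklore] -/
theorem sum_smul_pow_mul_mul_sum (ψ χ : ℕ → ℝ) (sA sB : Finset ℕ) (A M C : Matrix n n ℝ) :
    (∑ a ∈ sA, ψ a • A ^ a) * M * (∑ b ∈ sB, χ b • C ^ b)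
      = ∑ a ∈ sA, ∑ b ∈ sB, (ψ a * χ b) • (A ^ a * M * C ^ b) := by
  simp only [Finset.sum_mul, Finset.mul_sum, smul_mul_assoc, Matrix.mul_smul, smul_smul]
  rw [Finset.sum_comm]

/-- The finite BILINEAR IDENTITY behind (⋆):
`Σ_{a∈sA} Σ_{b∈sB} ψ_a χ_b · term(a,b) = uᵀ B^α ((Σ_a ψ_a (B²)^a) M (Σ_b χ_b (B̄²)^b)) B̄^β w`. [folklore] -/
theorem sum_sum_term (ψ χ : ℕ → ℝ) (sA sB : Finset ℕ) (u : n → ℝ) (B : Matrix n n ℝ) (α : ℕ)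
    (M : Matrix n n ℝ) (Bb : Matrix n n ℝ) (β : ℕ) (w : n → ℝ) :
    ∑ a ∈ sA, ∑ b ∈ sB, ψ a * χ b * term u B α M Bb β w (a, b)
      = u ⬝ᵥ ((B ^ α * ((∑ a ∈ sA, ψ a • (B * B) ^ a) * M * (∑ b ∈ sB, χ b • (Bb * Bb) ^ b)) * Bb ^ β) *ᵥ w) := by
  rw [sum_smul_pow_mul_mul_sum, ← sandwich_apply, map_sum]
  refine Finset.sum_congr rfl fun a _ => ?_
  rw [map_sum]
  refine Finset.sum_congr rfl fun b _ => ?_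
  rw [map_smul, smul_eq_mul, term_eq_sandwich]

/-- entries of `Σ_a ψ_a A^a` are `≥ 0`. [folklore] -/
theorem sum_smul_pow_apply_nonneg {ψ : ℕ → ℝ} (hψ : ∀ a, 0 ≤ ψ a) {A : Matrix n n ℝ} (hA : ∀ i j, 0 ≤ A i j)
    (s : Finset ℕ) (i j : n) : 0 ≤ (∑ a ∈ s, ψ a • A ^ a) i j := by
  rw [sum_apply']
  exact Finset.sum_nonneg fun a _ => by
    rw [Matrix.smul_apply, smul_eq_mul]; exact mul_nonneg (hψ a) (pow_apply_nonneg hA a i j)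

/-- The finite sums of (⋆) under entrywise partial-sum bounds `Σ_{a∈sA} ψ_a (B²)^a ≤ L`, `Σ_{b∈sB} χ_b (B̄²)^b ≤ R`:
`≤ uᵀ B^α (L M R) B̄^β w`. [folklore] -/
theorem sum_sum_term_le {ψ χ : ℕ → ℝ} (hψ : ∀ a, 0 ≤ ψ a) (hχ : ∀ b, 0 ≤ χ b) (h : NN u B M Bb w)
    {sA sB : Finset ℕ} {L R : Matrix n n ℝ} (hL : ∀ i j, (∑ a ∈ sA, ψ a • (B * B) ^ a) i j ≤ L i j)
    (hR : ∀ i j, (∑ b ∈ sB, χ b • (Bb * Bb) ^ b) i j ≤ R i j) (α β : ℕ) :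
    ∑ a ∈ sA, ∑ b ∈ sB, ψ a * χ b * term u B α M Bb β w (a, b)
      ≤ u ⬝ᵥ ((B ^ α * (L * M * R) * Bb ^ β) *ᵥ w) := by
  rw [sum_sum_term]
  have hB2 : ∀ i j, 0 ≤ (B * B) i j := mul_apply_nonneg h.B h.B
  have hBb2 : ∀ i j, 0 ≤ (Bb * Bb) i j := mul_apply_nonneg h.Bb h.Bb
  have hP0 := sum_smul_pow_apply_nonneg hψ hB2 sA
  have hQ0 := sum_smul_pow_apply_nonneg hχ hBb2 sB
  have hX0 : ∀ i j, 0 ≤ ((∑ a ∈ sA, ψ a • (B * B) ^ a) * M * (∑ b ∈ sB, χ b • (Bb * Bb) ^ b)) i j :=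
    mul_apply_nonneg (mul_apply_nonneg hP0 h.M) hQ0
  have hXle : ∀ i j, ((∑ a ∈ sA, ψ a • (B * B) ^ a) * M * (∑ b ∈ sB, χ b • (Bb * Bb) ^ b)) i j
      ≤ (L * M * R) i j :=
    mul_apply_mono (mul_apply_nonneg hP0 h.M) hQ0 (mul_apply_mono hP0 h.M hL (fun _ _ => le_rfl)) hR
  have hBa := pow_apply_nonneg h.B α
  have hBbb := pow_apply_nonneg h.Bb β
  have hY0 : ∀ i j, 0 ≤ (B ^ α * ((∑ a ∈ sA, ψ a • (B * B) ^ a) * M * (∑ b ∈ sB, χ b • (Bb * Bb) ^ b))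
      * Bb ^ β) i j := mul_apply_nonneg (mul_apply_nonneg hBa hX0) hBbb
  have hYle : ∀ i j, (B ^ α * ((∑ a ∈ sA, ψ a • (B * B) ^ a) * M * (∑ b ∈ sB, χ b • (Bb * Bb) ^ b))
      * Bb ^ β) i j ≤ (B ^ α * (L * M * R) * Bb ^ β) i j :=
    mul_apply_mono (mul_apply_nonneg hBa hX0) hBbb (mul_apply_mono hBa hX0 (fun _ _ => le_rfl) hXle)
      (fun _ _ => le_rfl)
  exact dotProduct_mono' h.u (mulVec_nonneg hY0 h.w) (fun _ => le_rfl) (mulVec_mono hY0 h.w hYle fun _ => le_rfl)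

/-- a finite set of index pairs lies in a square. [folklore] -/
theorem exists_subset_range_prod (s : Finset (ℕ × ℕ)) : ∃ N, s ⊆ range N ×ˢ range N := by
  refine ⟨s.sup (fun p => max p.1 p.2) + 1, fun p hp => ?_⟩
  have h := Finset.le_sup (f := fun p : ℕ × ℕ => max p.1 p.2) hp
  simp only [Finset.mem_product, Finset.mem_range]
  constructor <;> omega

/-- CLOSED-FORM MAJORANT of (⋆), all `(a,b)`: under UNIFORM partial-sum bounds `Σ_{a<N} ψ_a (B²)^a ≤ L`,
`Σ_{b<N} χ_b (B̄²)^b ≤ R` (all `N`) the series converges and is `≤ uᵀ B^α (L M R) B̄^β w`. [folklore] -/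
theorem ser_le {ψ χ : ℕ → ℝ} (hψ : ∀ a, 0 ≤ ψ a) (hχ : ∀ b, 0 ≤ χ b) (h : NN u B M Bb w)
    {L R : Matrix n n ℝ} (hL : ∀ N i j, (∑ a ∈ range N, ψ a • (B * B) ^ a) i j ≤ L i j)
    (hR : ∀ N i j, (∑ b ∈ range N, χ b • (Bb * Bb) ^ b) i j ≤ R i j) (α β : ℕ) :
    Summable (fun p => coef false ψ χ p * term u B α M Bb β w p) ∧
      ser false ψ χ u B α M Bb β w ≤ u ⬝ᵥ ((B ^ α * (L * M * R) * Bb ^ β) *ᵥ w) := by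
  have h0 : ∀ p, 0 ≤ coef false ψ χ p * term u B α M Bb β w p :=
    fun p => mul_term_nonneg h (coef_nonneg hψ hχ p) α β p
  have key : ∀ s : Finset (ℕ × ℕ), ∑ p ∈ s, coef false ψ χ p * term u B α M Bb β w p
      ≤ u ⬝ᵥ ((B ^ α * (L * M * R) * Bb ^ β) *ᵥ w) := by
    intro s
    obtain ⟨N, hN⟩ := exists_subset_range_prod s
    calc ∑ p ∈ s, coef false ψ χ p * term u B α M Bb β w p
        ≤ ∑ p ∈ range N ×ˢ range N, coef false ψ χ p * term u B α M Bb β w p :=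
          Finset.sum_le_sum_of_subset_of_nonneg hN fun p _ _ => h0 p
      _ = ∑ a ∈ range N, ∑ b ∈ range N, ψ a * χ b * term u B α M Bb β w (a, b) := by
          rw [Finset.sum_product]; simp only [coef_false]
      _ ≤ _ := sum_sum_term_le hψ hχ h (hL N) (hR N) α β
  exact ⟨summable_of_sum_le h0 key, Real.tsum_le_of_sum_le h0 key⟩

/-- CLOSED-FORM MAJORANT of (⋆), `(a,b) ≠ (0,0)`: as `ser_le`, minus the dropped term `ψ_0 χ_0 · uᵀ B^α M B̄^β w`.
[folklore] -/
theorem ser_drop_le {ψ χ : ℕ → ℝ} (hψ : ∀ a, 0 ≤ ψ a) (hχ : ∀ b, 0 ≤ χ b) (h : NN u B M Bb w)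
    {L R : Matrix n n ℝ} (hL : ∀ N i j, (∑ a ∈ range N, ψ a • (B * B) ^ a) i j ≤ L i j)
    (hR : ∀ N i j, (∑ b ∈ range N, χ b • (Bb * Bb) ^ b) i j ≤ R i j) (α β : ℕ) :
    Summable (fun p => coef true ψ χ p * term u B α M Bb β w p) ∧
      ser true ψ χ u B α M Bb β w
        ≤ u ⬝ᵥ ((B ^ α * (L * M * R) * Bb ^ β) *ᵥ w) - ψ 0 * χ 0 * (u ⬝ᵥ ((B ^ α * M * Bb ^ β) *ᵥ w)) := by
  classical
  have h0 : ∀ p, 0 ≤ coef true ψ χ p * term u B α M Bb β w p :=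
    fun p => mul_term_nonneg h (coef_nonneg hψ hχ p) α β p
  have h0' : ∀ p, 0 ≤ coef false ψ χ p * term u B α M Bb β w p :=
    fun p => mul_term_nonneg h (coef_nonneg hψ hχ p) α β p
  have ht0 : term u B α M Bb β w (0, 0) = u ⬝ᵥ ((B ^ α * M * Bb ^ β) *ᵥ w) := by simp [term]
  have key : ∀ s : Finset (ℕ × ℕ), ∑ p ∈ s, coef true ψ χ p * term u B α M Bb β w p
      ≤ u ⬝ᵥ ((B ^ α * (L * M * R) * Bb ^ β) *ᵥ w) - ψ 0 * χ 0 * (u ⬝ᵥ ((B ^ α * M * Bb ^ β) *ᵥ w)) := by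
    intro s
    obtain ⟨N, hN⟩ := exists_subset_range_prod (insert (0, 0) s)
    have h1 : ∑ p ∈ s, coef true ψ χ p * term u B α M Bb β w p
        = ∑ p ∈ (insert (0, 0) s).erase (0, 0), coef false ψ χ p * term u B α M Bb β w p := by
      rw [Finset.erase_insert_eq_erase,
        ← Finset.sum_erase s (f := fun p => coef true ψ χ p * term u B α M Bb β w p) (a := (0, 0))
          (by rw [coef_true_zero, zero_mul])]
      refine Finset.sum_congr rfl fun p hp => ?_
      rw [coef_of_ne ψ χ (Finset.ne_of_mem_erase hp), coef_false]
    have h2 := Finset.add_sum_erase (insert (0, 0) s) (fun p => coef false ψ χ p * term u B α M Bb β w p)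
      (Finset.mem_insert_self (0, 0) s)
    have h3 : ∑ p ∈ insert (0, 0) s, coef false ψ χ p * term u B α M Bb β w p
        ≤ u ⬝ᵥ ((B ^ α * (L * M * R) * Bb ^ β) *ᵥ w) :=
      calc ∑ p ∈ insert (0, 0) s, coef false ψ χ p * term u B α M Bb β w p
          ≤ ∑ p ∈ range N ×ˢ range N, coef false ψ χ p * term u B α M Bb β w p :=
            Finset.sum_le_sum_of_subset_of_nonneg hN fun p _ _ => h0' p
        _ = ∑ a ∈ range N, ∑ b ∈ range N, ψ a * χ b * term u B α M Bb β w (a, b) := by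
            rw [Finset.sum_product]; simp only [coef_false]
        _ ≤ _ := sum_sum_term_le hψ hχ h (hL N) (hR N) α β
    have h4 : coef false ψ χ (0, 0) * term u B α M Bb β w (0, 0)
        = ψ 0 * χ 0 * (u ⬝ᵥ ((B ^ α * M * Bb ^ β) *ᵥ w)) := by rw [coef_false, ht0]
    rw [h1]
    linarith
  exact ⟨summable_of_sum_le h0 key, Real.tsum_le_of_sum_le h0 key⟩

/-! ### The three certificates feeding `ser_le` / `ser_drop_le` -/

/-- `Σ_{a<N} 1·A^a ≤ S` from the Neumann certificate. [folklore] -/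
theorem cert_one {A S : Matrix n n ℝ} (hA : ∀ i j, 0 ≤ A i j) (hS0 : ∀ i j, 0 ≤ S i j) (hS : (1 - A) * S = 1)
    (N : ℕ) (i j : n) : (∑ a ∈ range N, kOne a • A ^ a) i j ≤ S i j := by
  simp only [kOne, one_smul]
  exact neumannPartial_apply_le hA hS0 hS N i j

/-- `Σ_{a<N} (a+1)·A^a ≤ S S` from the Neumann certificate. [folklore] -/
theorem cert_lin {A S : Matrix n n ℝ} (hA : ∀ i j, 0 ≤ A i j) (hS0 : ∀ i j, 0 ≤ S i j) (hS : (1 - A) * S = 1)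
    (N : ℕ) (i j : n) : (∑ a ∈ range N, kLin a • A ^ a) i j ≤ (S * S) i j :=
  neumannPartialW_apply_le hA hS0 hS N i j

/-- `Σ_{a<N} [a=0]·A^a ≤ 1`. [folklore] -/
theorem cert_delta (A : Matrix n n ℝ) (N : ℕ) (i j : n) : (∑ a ∈ range N, kDelta a • A ^ a) i j ≤ (1 : Matrix n n ℝ) i j := by
  rcases Nat.eq_zero_or_pos N with rfl | hN
  · simp only [Finset.range_zero, Finset.sum_empty, Matrix.zero_apply, Matrix.one_apply]
    split_ifs <;> norm_num
  · have h : ∑ a ∈ range N, kDelta a • A ^ a = 1 := by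
      rw [Finset.sum_eq_single 0]
      · simp [kDelta]
      · intro b _ hb; simp [kDelta, hb]
      · intro h; exact absurd (Finset.mem_range.2 hN) h
    rw [h]

end Series

/-! ## The coefficient kinds and their closed forms -/

section Kinds

variable {n : Type*} [Fintype n] [DecidableEq n]

/-- The three coefficient kinds of cells 41–42 as a finite type. [folklore] -/
inductive Kind | one | lin | delta
  deriving DecidableEq

namespace Kind

/-- the coefficient sequence of a kind. [folklore] -/
def c : Kind → ℕ → ℝ
  | one => kOne
  | lin => kLin
  | delta => kDelta

/-- every kind is `≥ 0`. [folklore] -/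
theorem c_nonneg : ∀ (k : Kind) (a : ℕ), 0 ≤ k.c a
  | one, a => kOne_nonneg a
  | lin, a => kLin_nonneg a
  | delta, a => kDelta_nonneg a

/-- every kind starts with `1` (so a dropped `(0,0)` term has coefficient `1`). [folklore] -/
theorem c_zero : ∀ k : Kind, k.c 0 = 1
  | one => kOne_zero
  | lin => kLin_zero
  | delta => kDelta_zero

/-- The CLOSED FORM of `Σ_a k(a) A^a` in terms of a two-sided inverse `S` of `1 − A`: `S`, `S²`, `1`
(`1/(1−e²)`, `1/(1−e²)²`, `1` of the notebook). [cite: FitznerVanDerHofstad2017, notebook Percolation.nb cells 41–42 (transcript l.1131–1175)] -/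
def L : Kind → Matrix n n ℝ → Matrix n n ℝ
  | one, S => S
  | lin, S => S * S
  | delta, _ => 1

/-- the partial sums of every kind are below its closed form (Neumann certificate). [folklore] -/
theorem cert {A S : Matrix n n ℝ} (hA : ∀ i j, 0 ≤ A i j) (hS0 : ∀ i j, 0 ≤ S i j) (hS : (1 - A) * S = 1) :
    ∀ (k : Kind) (N : ℕ) (i j : n), (∑ a ∈ range N, k.c a • A ^ a) i j ≤ (k.L S) i j
  | one, N, i, j => cert_one hA hS0 hS N i j
  | lin, N, i, j => cert_lin hA hS0 hS N i j
  | delta, N, i, j => cert_delta A N i j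

end Kind

omit [Fintype n] in
/-- entries of the identity matrix are `≥ 0`. [folklore] -/
theorem one_apply_nonneg (i j : n) : 0 ≤ (1 : Matrix n n ℝ) i j := by
  rw [Matrix.one_apply]; split_ifs <;> norm_num

/-- A READING of the symbol `Σ_j g_ψ(e_j) v_j · M · Σ_j g_χ(ē_j) v̄_j` of cells 41–42 (arguments: dropped?, `ψ`, `χ`,
`u`, `B`, `α`, `M`, `B̄`, `β`, `w`). [folklore] -/
abbrev Reading (n : Type*) [Fintype n] [DecidableEq n] :=
  Bool → Kind → Kind → (n → ℝ) → Matrix n n ℝ → ℕ → Matrix n n ℝ → Matrix n n ℝ → ℕ → (n → ℝ) → ℝ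

/-- THE SERIES READING (⋆) (what the symbol denotes, eigenvectors eliminated). [cite: FitznerVanDerHofstad2017, notebook Percolation.nb cells 32, 41–42 (transcript l.901–914, l.1131–1175)] -/
def Reading.series : Reading n := fun drop ψ χ u B α M Bb β w => ser drop ψ.c χ.c u B α M Bb β w

/-- THE CLOSED-FORM READING at candidate inverses `S` of `1 − B²` and `S̄` of `1 − B̄²`:
`uᵀ B^α (L_ψ(S) M L_χ(S̄)) B̄^β w`, minus `uᵀ B^α M B̄^β w` if dropped. [cite: FitznerVanDerHofstad2017, notebook Percolation.nb cells 41–42 (transcript l.1131–1175)] -/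
def Reading.closed (S Sb : Matrix n n ℝ) : Reading n := fun drop ψ χ u B α M Bb β w =>
  u ⬝ᵥ ((B ^ α * (ψ.L S * M * χ.L Sb) * Bb ^ β) *ᵥ w) - if drop then u ⬝ᵥ ((B ^ α * M * Bb ^ β) *ᵥ w) else 0

/-- a reading is `≥ 0` on non-negative ingredients with the given `B`, `B̄`. [folklore] -/
def Reading.NonnegAt (Φ : Reading n) (B Bb : Matrix n n ℝ) : Prop :=
  ∀ drop ψ χ u α M β w, NN u B M Bb w → 0 ≤ Φ drop ψ χ u B α M Bb β w

/-- two readings compare on non-negative ingredients with the given `B`, `B̄`. [folklore] -/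
def Reading.LEAt (Φ Ψ : Reading n) (B Bb : Matrix n n ℝ) : Prop :=
  ∀ drop ψ χ u α M β w, NN u B M Bb w → Φ drop ψ χ u B α M Bb β w ≤ Ψ drop ψ χ u B α M Bb β w

/-- `LEAt` is reflexive. [folklore] -/
theorem Reading.LEAt.refl' (Φ : Reading n) (B Bb : Matrix n n ℝ) : Φ.LEAt Φ B Bb :=
  fun _ _ _ _ _ _ _ _ _ => le_rfl

/-- the series reading is `≥ 0`. [folklore] -/
theorem Reading.series_nonnegAt (B Bb : Matrix n n ℝ) : (Reading.series (n := n)).NonnegAt B Bb :=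
  fun _ ψ χ _ α _ β _ h => ser_nonneg ψ.c_nonneg χ.c_nonneg h α β

/-- SERIES ≤ CLOSED FORM under the two Neumann certificates (`ser_le`, `ser_drop_le`, `Kind.cert`). [folklore] -/
theorem Reading.series_leAt_closed {B Bb S Sb : Matrix n n ℝ} (hB : ∀ i j, 0 ≤ B i j) (hBb : ∀ i j, 0 ≤ Bb i j)
    (hS0 : ∀ i j, 0 ≤ S i j) (hS : (1 - B * B) * S = 1) (hSb0 : ∀ i j, 0 ≤ Sb i j) (hSb : (1 - Bb * Bb) * Sb = 1) :
    (Reading.series (n := n)).LEAt (Reading.closed S Sb) B Bb := by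
  intro drop ψ χ u α M β w h
  have hL := Kind.cert (mul_apply_nonneg hB hB) hS0 hS ψ
  have hR := Kind.cert (mul_apply_nonneg hBb hBb) hSb0 hSb χ
  cases drop
  · have h1 := (ser_le ψ.c_nonneg χ.c_nonneg h hL hR α β).2
    simpa only [Reading.series, Reading.closed, Bool.false_eq_true, if_false, sub_zero] using h1
  · have h1 := (ser_drop_le ψ.c_nonneg χ.c_nonneg h hL hR α β).2
    rw [ψ.c_zero, χ.c_zero, one_mul, one_mul] at h1
    simpa only [Reading.series, Reading.closed, if_true] using h1

end Kinds

/-! ## Cells 41–42 as tables of pieces -/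

section Pieces

/-- the left vectors `u` of cells 41–42: `P^S`, `P^ι`, `h^S.AiotaNonRepᵀ`, `h^{ιι}`. [cite: FitznerVanDerHofstad2017, notebook Percolation.nb cells 41–42 (transcript l.1131–1175)] -/
inductive USym | PS | Piota | hSAtNR | hII
  deriving DecidableEq

/-- the middle matrices `M` of cells 41–42: `AiotabarNonRep`, none, `C₁`, `C₂`, `C₁B̄ + BC₂`, `C₂B̄ + BC₁`. [cite: FitznerVanDerHofstad2017, notebook Percolation.nb cells 41–42 (transcript l.1131–1175)] -/
inductive MSym | AbarNR | one | C1 | C2 | C1BbBC2 | C2BbBC1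
  deriving DecidableEq

/-- the right vectors `w` of cells 41–42: `P^E`, `H₃P^E + AiotaNonRep.h^E`, `H₂P^E + AiotaNonRep.h^E`. [cite: FitznerVanDerHofstad2017, notebook Percolation.nb cells 41–42 (transcript l.1131–1175)] -/
inductive WSym | PE | H3PEAhE | H2PEAhE
  deriving DecidableEq

/-- One summand `c · [Σ_j g_ψ v_j](u, α) · M · [Σ_j g_χ v̄_j](β, w)` of a cell-41/42 tail; `drop` marks the pairs whose
`(0,0)` term the notebook subtracts. [cite: FitznerVanDerHofstad2017, notebook Percolation.nb cells 41–42 (transcript l.1131–1175)] -/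
structure Piece where
  /-- the natural-number coefficient printed in the cell -/
  c : ℕ
  /-- `(0,0)` term subtracted -/
  drop : Bool
  /-- kind on the `B` side -/
  ψ : Kind
  /-- kind on the `B̄` side -/
  χ : Kind
  /-- left vector -/
  u : USym
  /-- extra power of `B` (`e_j^α`) -/
  α : ℕ
  /-- middle matrix -/
  M : MSym
  /-- extra power of `B̄` (`ē_j^β`) -/
  β : ℕ
  /-- right vector -/
  w : WSym

namespace Tail

/-- Cell 41: `Bound[Xi,EvenTail,s] − Bound[Xi,2,s] = Σ_j e_j³/(1−e_j²) v_j.AiotabarNonRep.P^E`. [cite: FitznerVanDerHofstad2017, notebook Percolation.nb cell 41 (transcript l.1139)] -/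
def xiEven : List Piece := [⟨1, false, .one, .delta, .PS, 3, .AbarNR, 0, .PE⟩]

/-- Cell 41: `Bound[Xi,OddTail,s] − Bound[Xi,3,s] = Σ_j e_j⁴/(1−e_j²) v_j.AiotabarNonRep.P^E`. [cite: FitznerVanDerHofstad2017, notebook Percolation.nb cell 41 (transcript l.1140)] -/
def xiOdd : List Piece := [⟨1, false, .one, .delta, .PS, 4, .AbarNR, 0, .PE⟩]

/-- Cell 41: `Bound[XiIota,EvenTail,s] − Bound[XiIota,2,s]` (as `xiEven` with `P^ι`). [cite: FitznerVanDerHofstad2017, notebook Percolation.nb cell 41 (transcript l.1141)] -/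
def xiIotaEven : List Piece := [⟨1, false, .one, .delta, .Piota, 3, .AbarNR, 0, .PE⟩]

/-- Cell 41: `Bound[XiIota,OddTail,s] − Bound[XiIota,3,s]` (as `xiOdd` with `P^ι`). [cite: FitznerVanDerHofstad2017, notebook Percolation.nb cell 41 (transcript l.1142)] -/
def xiIotaOdd : List Piece := [⟨1, false, .one, .delta, .Piota, 4, .AbarNR, 0, .PE⟩]

/-- Cell 42: `Bound[Xi,EvenTail,Delta,s] − Bound[Xi,2,Delta,s]` =
`h^S.AiotaNonRepᵀ.Σ_j v̄_j ē_j³(2/(1−ē_j²)² + 4/(1−ē_j²)) + Σ_j e_j³(2/(1−e_j²)² + 4/(1−e_j²)) v_j.(H₃P^E + AiotaNonRep.h^E)`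
`+ 2Σ_j v_j/(1−e_j²).C₁.Σ_j v̄_j/(1−ē_j²)² + 2Σ_j v_j/(1−e_j²)².C₁.Σ_j v̄_j/(1−ē_j²) − 4P^S.C₁.P^E`
`+ 2Σ_j v_j e_j/(1−e_j²).C₂.Σ_j v̄_j ē_j(1/(1−ē_j²)² + 1/(1−ē_j²)) + 2Σ_j v_j e_j/(1−e_j²)².C₂.Σ_j v̄_j ē_j/(1−ē_j²)`.
[cite: FitznerVanDerHofstad2017, notebook Percolation.nb cell 42 (transcript l.1161)] -/
def xiEvenDelta : List Piece :=
  [⟨2, false, .delta, .lin, .hSAtNR, 0, .one, 3, .PE⟩, ⟨4, false, .delta, .one, .hSAtNR, 0, .one, 3, .PE⟩,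
   ⟨2, false, .lin, .delta, .PS, 3, .one, 0, .H3PEAhE⟩, ⟨4, false, .one, .delta, .PS, 3, .one, 0, .H3PEAhE⟩,
   ⟨2, true, .one, .lin, .PS, 0, .C1, 0, .PE⟩, ⟨2, true, .lin, .one, .PS, 0, .C1, 0, .PE⟩,
   ⟨2, false, .one, .lin, .PS, 1, .C2, 1, .PE⟩, ⟨2, false, .one, .one, .PS, 1, .C2, 1, .PE⟩,
   ⟨2, false, .lin, .one, .PS, 1, .C2, 1, .PE⟩]

/-- Cell 42: `Bound[Xi,OddTail,Delta,s] − Bound[Xi,3,Delta,s]` =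
`h^S.AiotaNonRepᵀ.Σ_j v̄_j ē_j⁴(2/(1−ē_j²)² + 5/(1−ē_j²)) + Σ_j e_j⁴(2/(1−e_j²)² + 5/(1−e_j²)) v_j.(H₃P^E + AiotaNonRep.h^E)`
`+ Σ_j 2v_j/(1−e_j²)².(C₁B̄+BC₂).Σ_j v̄_j/(1−ē_j²) + Σ_j v_j/(1−e_j²).(C₁B̄+BC₂).Σ_j v̄_j(2/(1−ē_j²)² + 1/(1−ē_j²)) − 5P^S.(C₁B̄+BC₂).P^E`.
[cite: FitznerVanDerHofstad2017, notebook Percolation.nb cell 42 (transcript l.1163–1164)] -/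
def xiOddDelta : List Piece :=
  [⟨2, false, .delta, .lin, .hSAtNR, 0, .one, 4, .PE⟩, ⟨5, false, .delta, .one, .hSAtNR, 0, .one, 4, .PE⟩,
   ⟨2, false, .lin, .delta, .PS, 4, .one, 0, .H3PEAhE⟩, ⟨5, false, .one, .delta, .PS, 4, .one, 0, .H3PEAhE⟩,
   ⟨2, true, .lin, .one, .PS, 0, .C1BbBC2, 0, .PE⟩, ⟨2, true, .one, .lin, .PS, 0, .C1BbBC2, 0, .PE⟩,
   ⟨1, true, .one, .one, .PS, 0, .C1BbBC2, 0, .PE⟩]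

/-- Cell 42: `Bound[XiIota,EvenTail,Delta,ei,s] − Bound[XiIota,2,Delta,ei,s]` =
`h^{ιι}.Σ_j v̄_j ē_j³(2/(1−ē_j²)² + 3/(1−ē_j²)) + Σ_j e_j³ v^ι_j(2/(1−e_j²)² + 3/(1−e_j²)).(H₃P^E + AiotaNonRep.h^E)`
`+ Σ_j v^ι_j 2e_j/(1−e_j²)².(C₂B̄+BC₁).Σ_j v̄_j/(1−ē_j²) + Σ_j v^ι_j e_j/(1−e_j²).(C₂B̄+BC₁).Σ_j v̄_j(2/(1−ē_j²)² + 1/(1−ē_j²))`.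
[cite: FitznerVanDerHofstad2017, notebook Percolation.nb cell 42 (transcript l.1166)] -/
def xiIotaEvenDeltaEi : List Piece :=
  [⟨2, false, .delta, .lin, .hII, 0, .one, 3, .PE⟩, ⟨3, false, .delta, .one, .hII, 0, .one, 3, .PE⟩,
   ⟨2, false, .lin, .delta, .Piota, 3, .one, 0, .H3PEAhE⟩, ⟨3, false, .one, .delta, .Piota, 3, .one, 0, .H3PEAhE⟩,
   ⟨2, false, .lin, .one, .Piota, 1, .C2BbBC1, 0, .PE⟩, ⟨2, false, .one, .lin, .Piota, 1, .C2BbBC1, 0, .PE⟩,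
   ⟨1, false, .one, .one, .Piota, 1, .C2BbBC1, 0, .PE⟩]

/-- Cell 42: `Bound[XiIota,OddTail,Delta,ei,s] − Bound[XiIota,3,Delta,ei,s]` =
`h^{ιι}.Σ_j v̄_j ē_j⁴(2/(1−ē_j²)² + 4/(1−ē_j²)) + Σ_j e_j⁴(2/(1−e_j²)² + 4/(1−e_j²)) v^ι_j.(H₂P^E + AiotaNonRep.h^E)`
`+ Σ_j v^ι_j 2e_j/(1−e_j²)².C₂.Σ_j v̄_j/(1−ē_j²) + Σ_j v^ι_j e_j/(1−e_j²).C₂.Σ_j 2v̄_j/(1−ē_j²)² − 4P^ι.B.C₂.P^E`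
`+ Σ_j v^ι_j 2e_j²/(1−e_j²)².C₁.Σ_j v̄_j/(1−ē_j²) + Σ_j v^ι_j e_j²/(1−e_j²).C₁.Σ_j v̄_j(2/(1−ē_j²)² + 2/(1−ē_j²))`.
[cite: FitznerVanDerHofstad2017, notebook Percolation.nb cell 42 (transcript l.1167)] -/
def xiIotaOddDeltaEi : List Piece :=
  [⟨2, false, .delta, .lin, .hII, 0, .one, 4, .PE⟩, ⟨4, false, .delta, .one, .hII, 0, .one, 4, .PE⟩,
   ⟨2, false, .lin, .delta, .Piota, 4, .one, 0, .H2PEAhE⟩, ⟨4, false, .one, .delta, .Piota, 4, .one, 0, .H2PEAhE⟩,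
   ⟨2, true, .lin, .one, .Piota, 1, .C2, 0, .PE⟩, ⟨2, true, .one, .lin, .Piota, 1, .C2, 0, .PE⟩,
   ⟨2, false, .lin, .one, .Piota, 2, .C1, 0, .PE⟩, ⟨2, false, .one, .lin, .Piota, 2, .C1, 0, .PE⟩,
   ⟨2, false, .one, .one, .Piota, 2, .C1, 0, .PE⟩]

/-- Cell 42: `Bound[XiIota,EvenTail,Delta,0,s] − Bound[XiIota,2,Delta,0,s]` =
`Σ_j e_j³/(1−e_j²)(2 + 4/(1−e_j²)) v^ι_j.AiotabarNonRep.P^E + h^{ιι}.Σ_j v̄_j ē_j³(2/(1−ē_j²)² + 4/(1−ē_j²))`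
`+ Σ_j e_j³ v^ι_j(2/(1−e_j²)² + 4/(1−e_j²)).(H₃P^E + AiotaNonRep.h^E)`
`+ Σ_j v^ι_j 2e_j/(1−e_j²)².(C₂B̄+BC₁).Σ_j v̄_j/(1−ē_j²) + Σ_j v^ι_j e_j/(1−e_j²).(C₂B̄+BC₁).Σ_j v̄_j(2/(1−ē_j²)² + 4/(1−ē_j²))`.
[cite: FitznerVanDerHofstad2017, notebook Percolation.nb cell 42 (transcript l.1169)] -/
def xiIotaEvenDeltaZero : List Piece :=
  [⟨2, false, .one, .delta, .Piota, 3, .AbarNR, 0, .PE⟩, ⟨4, false, .lin, .delta, .Piota, 3, .AbarNR, 0, .PE⟩,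
   ⟨2, false, .delta, .lin, .hII, 0, .one, 3, .PE⟩, ⟨4, false, .delta, .one, .hII, 0, .one, 3, .PE⟩,
   ⟨2, false, .lin, .delta, .Piota, 3, .one, 0, .H3PEAhE⟩, ⟨4, false, .one, .delta, .Piota, 3, .one, 0, .H3PEAhE⟩,
   ⟨2, false, .lin, .one, .Piota, 1, .C2BbBC1, 0, .PE⟩, ⟨2, false, .one, .lin, .Piota, 1, .C2BbBC1, 0, .PE⟩,
   ⟨4, false, .one, .one, .Piota, 1, .C2BbBC1, 0, .PE⟩]

/-- Cell 42: `Bound[XiIota,OddTail,Delta,0,s] − Bound[XiIota,3,Delta,0,s]` =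
`Σ_j e_j⁴/(1−e_j²)(2 + 5/(1−e_j²)) v^ι_j.AiotabarNonRep.P^E + h^{ιι}.Σ_j v̄_j ē_j⁴(2/(1−ē_j²)² + 5/(1−ē_j²))`
`+ Σ_j e_j⁴ v^ι_j(2/(1−e_j²)² + 5/(1−e_j²)).(H₂P^E + AiotaNonRep.h^E)`
`+ Σ_j v^ι_j 2e_j/(1−e_j²)².C₂.Σ_j v̄_j/(1−ē_j²) + Σ_j v^ι_j e_j/(1−e_j²).C₂.Σ_j v̄_j(2/(1−ē_j²)² + 1/(1−ē_j²)) − 5P^ι.B.C₂.P^E`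
`+ Σ_j v^ι_j 2e_j²/(1−e_j²)².C₁.Σ_j v̄_j/(1−ē_j²) + Σ_j v^ι_j e_j²/(1−e_j²).C₁.Σ_j v̄_j(2/(1−ē_j²)² + 3/(1−ē_j²))`.
[cite: FitznerVanDerHofstad2017, notebook Percolation.nb cell 42 (transcript l.1170)] -/
def xiIotaOddDeltaZero : List Piece :=
  [⟨2, false, .one, .delta, .Piota, 4, .AbarNR, 0, .PE⟩, ⟨5, false, .lin, .delta, .Piota, 4, .AbarNR, 0, .PE⟩,
   ⟨2, false, .delta, .lin, .hII, 0, .one, 4, .PE⟩, ⟨5, false, .delta, .one, .hII, 0, .one, 4, .PE⟩,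
   ⟨2, false, .lin, .delta, .Piota, 4, .one, 0, .H2PEAhE⟩, ⟨5, false, .one, .delta, .Piota, 4, .one, 0, .H2PEAhE⟩,
   ⟨2, true, .lin, .one, .Piota, 1, .C2, 0, .PE⟩, ⟨2, true, .one, .lin, .Piota, 1, .C2, 0, .PE⟩,
   ⟨1, true, .one, .one, .Piota, 1, .C2, 0, .PE⟩,
   ⟨2, false, .lin, .one, .Piota, 2, .C1, 0, .PE⟩, ⟨2, false, .one, .lin, .Piota, 2, .C1, 0, .PE⟩,
   ⟨3, false, .one, .one, .Piota, 2, .C1, 0, .PE⟩]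

end Tail

end Pieces

/-! ## Ingredients, totals, and the instance over a typed frame -/

section Totals

variable {n : Type*} [Fintype n] [DecidableEq n]

/-- The ingredients of cells 41–42 at one point as real vectors and matrices. [folklore] -/
structure Ingr (n : Type*) [Fintype n] [DecidableEq n] where
  /-- left vectors -/
  u : USym → n → ℝ
  /-- middle matrices -/
  m : MSym → Matrix n n ℝ
  /-- right vectors -/
  w : WSym → n → ℝ
  /-- `B` -/
  B : Matrix n n ℝ
  /-- `B̄` -/
  Bb : Matrix n n ℝ

/-- all ingredients entrywise `≥ 0`. [folklore] -/
structure Ingr.Nonneg (I : Ingr n) : Prop where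
  u : ∀ t i, 0 ≤ I.u t i
  m : ∀ t i j, 0 ≤ I.m t i j
  w : ∀ t i, 0 ≤ I.w t i
  B : ∀ i j, 0 ≤ I.B i j
  Bb : ∀ i j, 0 ≤ I.Bb i j

/-- the ingredient tuple of any piece is non-negative. [folklore] -/
theorem Ingr.Nonneg.nn {I : Ingr n} (h : I.Nonneg) (a : USym) (b : MSym) (c : WSym) :
    NN (I.u a) I.B (I.m b) I.Bb (I.w c) :=
  ⟨h.u a, h.B, h.m b, h.Bb, h.w c⟩

/-- the value of one piece under a reading. [folklore] -/
def Piece.val (Φ : Reading n) (I : Ingr n) (π : Piece) : ℝ :=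
  (π.c : ℝ) * Φ π.drop π.ψ π.χ (I.u π.u) I.B π.α (I.m π.M) I.Bb π.β (I.w π.w)

/-- the value of a table of pieces under a reading. [folklore] -/
def total (Φ : Reading n) (I : Ingr n) (l : List Piece) : ℝ := (l.map (Piece.val Φ I)).sum

/-- empty table. [folklore] -/
@[simp] theorem total_nil (Φ : Reading n) (I : Ingr n) : total Φ I [] = 0 := by simp [total]

/-- table with a head piece. [folklore] -/
@[simp] theorem total_cons (Φ : Reading n) (I : Ingr n) (π : Piece) (l : List Piece) :
    total Φ I (π :: l) = π.val Φ I + total Φ I l := by simp [total]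

/-- a table of pieces is `≥ 0` under a non-negative reading. [folklore] -/
theorem total_nonneg {Φ : Reading n} {I : Ingr n} (hΦ : Φ.NonnegAt I.B I.Bb) (hI : I.Nonneg) :
    ∀ l : List Piece, 0 ≤ total Φ I l
  | [] => by simp
  | π :: l => by
    rw [total_cons]
    exact add_nonneg (mul_nonneg (Nat.cast_nonneg _) (hΦ _ _ _ _ _ _ _ _ (hI.nn _ _ _))) (total_nonneg hΦ hI l)

/-- a table of pieces is monotone in the reading. [folklore] -/
theorem total_mono {Φ Ψ : Reading n} {I : Ingr n} (h : Φ.LEAt Ψ I.B I.Bb) (hI : I.Nonneg) :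
    ∀ l : List Piece, total Φ I l ≤ total Ψ I l
  | [] => by simp
  | π :: l => by
    rw [total_cons, total_cons]
    exact add_le_add (mul_le_mul_of_nonneg_left (h _ _ _ _ _ _ _ _ (hI.nn _ _ _)) (Nat.cast_nonneg _))
      (total_mono h hI l)

end Totals

section Frame

open Stage1Cells NoGoFrame BetaMap

variable {ν : Type*}

/-- `h^S.AiotaNonRepᵀ` (cell 42; cells 38–40 use `Aiota` here, cell 42 prints `AiotaNonRep`). [cite: FitznerVanDerHofstad2017, notebook Percolation.nb cell 42 (transcript l.1161–1164)] -/
def hSAtNR (P : Params) : Vec := vecMul (hS P) (tr (AiotaNR P))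

/-- `H₃.P^E + AiotaNonRep.h^E` (cell 42). [cite: FitznerVanDerHofstad2017, notebook Percolation.nb cell 42 (transcript l.1161–1169)] -/
def H3PEAhE (P : Params) : Vec := vadd (Stage1Cells.mulVec (H3 P) (PE P)) (Stage1Cells.mulVec (AiotaNR P) (hE P))

/-- `H₂.P^E + AiotaNonRep.h^E` (cell 42). [cite: FitznerVanDerHofstad2017, notebook Percolation.nb cell 42 (transcript l.1167–1170)] -/
def H2PEAhE (P : Params) : Vec := vadd (Stage1Cells.mulVec (H2 P) (PE P)) (Stage1Cells.mulVec (AiotaNR P) (hE P))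

/-- `C₂.B̄ + B.C₁` (cell 42). [cite: FitznerVanDerHofstad2017, notebook Percolation.nb cell 42 (transcript l.1166–1169)] -/
def C2BbarBC1 (P : Params) : Mat := madd (matMul (C2 P) (Bbar P)) (matMul (B P) (C1 P))

/-- a typed vector of cells as a real vector at `(s, y)`. [folklore] -/
def evV (D : Data ν) (s : Pt) (y : State) (v : Vec) : Fin 3 → ℝ := fun a => D.ev s y (v a)

/-- a typed matrix of cells as a real matrix at `(s, y)`. [folklore] -/
def evM (D : Data ν) (s : Pt) (y : State) (Mx : Mat) : Matrix (Fin 3) (Fin 3) ℝ :=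
  Matrix.of fun a b => D.ev s y (Mx a b)

/-- The ingredients of cells 41–42 over the typed frame `D` at `(s, y)`. [cite: FitznerVanDerHofstad2017, notebook Percolation.nb cells 30–31, 41–42 (transcript l.840–888, l.1131–1175)] -/
def ingr (D : Data ν) (s : Pt) (y : State) : Ingr (Fin 3) where
  u := fun
    | .PS => evV D s y (PS D.P)
    | .Piota => evV D s y (Piota D.P)
    | .hSAtNR => evV D s y (hSAtNR D.P)
    | .hII => evV D s y (hII D.P)
  m := fun
    | .AbarNR => evM D s y (AiotabarNR D.P)
    | .one => 1
    | .C1 => evM D s y (C1 D.P)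
    | .C2 => evM D s y (C2 D.P)
    | .C1BbBC2 => evM D s y (C1BbarBC2 D.P)
    | .C2BbBC1 => evM D s y (C2BbarBC1 D.P)
  w := fun
    | .PE => evV D s y (PE D.P)
    | .H3PEAhE => evV D s y (H3PEAhE D.P)
    | .H2PEAhE => evV D s y (H2PEAhE D.P)
  B := evM D s y (B D.P)
  Bb := evM D s y (Bbar D.P)

/-- where every cell is `≥ 0` the ingredients are `≥ 0`. [folklore] -/
theorem ingr_nonneg {D : Data ν} {s : Pt} {y : State} (hev : ∀ e, 0 ≤ D.ev s y e) : (ingr D s y).Nonneg where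
  u t i := by cases t <;> exact hev _
  m t i j := by
    cases t
    case one => exact one_apply_nonneg i j
    all_goals exact hev _
  w t i := by cases t <;> exact hev _
  B i j := hev _
  Bb i j := hev _

/-- the value at `(s, y)` of a cell-41/42 table under the reading `Φ`. [folklore] -/
def tailVal (Φ : Reading (Fin 3)) (D : Data ν) (y : State) (s : Pt) (l : List Piece) : ℝ :=
  total Φ (ingr D s y) l

/-- Cell 44 with the `N ≥ 4` tails of cells 41–43 READ BY `Φ` added to the tail-free record `Data.inp` (`T″₀`):
`EvenTail = Bound[·,2,·] + tail`, `OddTail = Bound[·,3,·] + tail`, and cell 43's sums `Even = 0 + EvenTail`,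
`Odd = 1 + OddTail`, `Absolut = Odd + Even` accordingly (twenty-two fields move; the rest is `Data.inp`).
[cite: FitznerVanDerHofstad2017, notebook Percolation.nb cells 43–44 (transcript l.1182–1202, l.1214–1237)] -/
def inpT (Φ : Pt → Reading (Fin 3)) (D : Data ν) (y : State) (s : Pt) : Inputs :=
  { D.inp y s with
    xiAbs := (D.inp y s).xiAbs + (tailVal (Φ s) D y s Tail.xiOdd + tailVal (Φ s) D y s Tail.xiEven)
    xiOdd := (D.inp y s).xiOdd + tailVal (Φ s) D y s Tail.xiOdd
    xiEven := (D.inp y s).xiEven + tailVal (Φ s) D y s Tail.xiEven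
    xiEvenTail := (D.inp y s).xiEvenTail + tailVal (Φ s) D y s Tail.xiEven
    xiOddTail := (D.inp y s).xiOddTail + tailVal (Φ s) D y s Tail.xiOdd
    xiDeltaAbs := (D.inp y s).xiDeltaAbs
      + (tailVal (Φ s) D y s Tail.xiOddDelta + tailVal (Φ s) D y s Tail.xiEvenDelta)
    xiOddDelta := (D.inp y s).xiOddDelta + tailVal (Φ s) D y s Tail.xiOddDelta
    xiEvenDelta := (D.inp y s).xiEvenDelta + tailVal (Φ s) D y s Tail.xiEvenDelta
    xiOddTailDelta := (D.inp y s).xiOddTailDelta + tailVal (Φ s) D y s Tail.xiOddDelta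
    xiEvenTailDelta := (D.inp y s).xiEvenTailDelta + tailVal (Φ s) D y s Tail.xiEvenDelta
    xiIotaAbs := (D.inp y s).xiIotaAbs + (tailVal (Φ s) D y s Tail.xiIotaOdd + tailVal (Φ s) D y s Tail.xiIotaEven)
    xiIotaOdd := (D.inp y s).xiIotaOdd + tailVal (Φ s) D y s Tail.xiIotaOdd
    xiIotaEven := (D.inp y s).xiIotaEven + tailVal (Φ s) D y s Tail.xiIotaEven
    xiIotaEvenTail := (D.inp y s).xiIotaEvenTail + tailVal (Φ s) D y s Tail.xiIotaEven
    xiIotaDeltaEi := (D.inp y s).xiIotaDeltaEi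
      + (tailVal (Φ s) D y s Tail.xiIotaOddDeltaEi + tailVal (Φ s) D y s Tail.xiIotaEvenDeltaEi)
    xiIotaOddDeltaEi := (D.inp y s).xiIotaOddDeltaEi + tailVal (Φ s) D y s Tail.xiIotaOddDeltaEi
    xiIotaEvenDeltaEi := (D.inp y s).xiIotaEvenDeltaEi + tailVal (Φ s) D y s Tail.xiIotaEvenDeltaEi
    xiIotaEvenTailDeltaEi := (D.inp y s).xiIotaEvenTailDeltaEi + tailVal (Φ s) D y s Tail.xiIotaEvenDeltaEi
    xiIotaDeltaZero := (D.inp y s).xiIotaDeltaZero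
      + (tailVal (Φ s) D y s Tail.xiIotaOddDeltaZero + tailVal (Φ s) D y s Tail.xiIotaEvenDeltaZero)
    xiIotaOddDeltaZero := (D.inp y s).xiIotaOddDeltaZero + tailVal (Φ s) D y s Tail.xiIotaOddDeltaZero
    xiIotaEvenDeltaZero := (D.inp y s).xiIotaEvenDeltaZero + tailVal (Φ s) D y s Tail.xiIotaEvenDeltaZero
    xiIotaEvenTailDeltaZero := (D.inp y s).xiIotaEvenTailDeltaZero + tailVal (Φ s) D y s Tail.xiIotaEvenDeltaZero }

/-- CELL 44 AS THE NOTEBOOK ITERATES IT: the App. D input record WITH the `N ≥ 4` tails (series reading).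
[cite: FitznerVanDerHofstad2017, notebook Percolation.nb cells 41–44 (transcript l.1131–1237)] -/
def inpFull (D : Data ν) (y : State) (s : Pt) : Inputs := inpT (fun _ => Reading.series) D y s

/-- The closed-form MAJORANT record at candidate inverses `S s` of `1 − B(s)²` and `S̄ s` of `1 − B̄(s)²`.
[cite: FitznerVanDerHofstad2017, notebook Percolation.nb cells 41–44 (transcript l.1131–1237)] -/
def inpMaj (S Sb : Pt → Matrix (Fin 3) (Fin 3) ℝ) (D : Data ν) (y : State) (s : Pt) : Inputs :=
  inpT (fun s => Reading.closed (S s) (Sb s)) D y s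

variable {D : Data ν} {y : State} {s : Pt}

/-- `Data.inp ≤ inpT Φ` for a non-negative reading. [folklore] -/
theorem inp_dom_inpT {Φ : Pt → Reading (Fin 3)} (hΦ : (Φ s).NonnegAt (ingr D s y).B (ingr D s y).Bb)
    (hI : (ingr D s y).Nonneg) : (D.inp y s).Dom (inpT Φ D y s) where
  mu := le_rfl
  muMin := le_rfl
  mubOverMu := le_rfl
  mub := le_rfl
  xiAlphaOneMinusZeroAtZero := le_rfl
  xiAlphaZeroMinusOneAtZero := le_rfl
  xiAlphaOneMinusZeroAtEi := le_rfl
  xiAlphaZeroMinusOneAtEi := le_rfl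
  xiIotaAlphaIAtEi := le_rfl
  xiIotaAlphaIIAtZero := le_rfl
  xiIotaAlphaISumAroundEi := le_rfl
  xiIotaAlphaIISumAroundZero := le_rfl
  psiAlphaIOneMinusZeroAroundEi := le_rfl
  psiAlphaIIZeroMinusOneAroundZero := le_rfl
  psiAlphaIZeroMinusOneAroundEi := le_rfl
  psiAlphaIIOneMinusZeroAroundZero := le_rfl
  piAlpha := le_rfl
  piAlphaLower := le_rfl
  piOneLower := le_rfl
  psiZeroLower := le_rfl
  xiAbs := le_add_of_nonneg_right (add_nonneg (total_nonneg hΦ hI _) (total_nonneg hΦ hI _))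
  xiOdd := le_add_of_nonneg_right (total_nonneg hΦ hI _)
  xiEven := le_add_of_nonneg_right (total_nonneg hΦ hI _)
  xiEvenTail := le_add_of_nonneg_right (total_nonneg hΦ hI _)
  xiOddTail := le_add_of_nonneg_right (total_nonneg hΦ hI _)
  xiR0 := le_rfl
  xiR1 := le_rfl
  xiR0Delta := le_rfl
  xiR1Delta := le_rfl
  xiDeltaAbs := le_add_of_nonneg_right (add_nonneg (total_nonneg hΦ hI _) (total_nonneg hΦ hI _))
  xiOddDelta := le_add_of_nonneg_right (total_nonneg hΦ hI _)
  xiEvenDelta := le_add_of_nonneg_right (total_nonneg hΦ hI _)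
  xiOddTailDelta := le_add_of_nonneg_right (total_nonneg hΦ hI _)
  xiEvenTailDelta := le_add_of_nonneg_right (total_nonneg hΦ hI _)
  psiRI0 := le_rfl
  psiRI1 := le_rfl
  psiRII0 := le_rfl
  psiRII1 := le_rfl
  psiRI0Delta := le_rfl
  psiRI1Delta := le_rfl
  psiRII0Delta := le_rfl
  psiRII1Delta := le_rfl
  piR0 := le_rfl
  piR0DeltaEiEk := le_rfl
  xiIotaAbs := le_add_of_nonneg_right (add_nonneg (total_nonneg hΦ hI _) (total_nonneg hΦ hI _))
  xiIotaOdd := le_add_of_nonneg_right (total_nonneg hΦ hI _)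
  xiIotaEven := le_add_of_nonneg_right (total_nonneg hΦ hI _)
  xiIotaEvenTail := le_add_of_nonneg_right (total_nonneg hΦ hI _)
  xiIotaRI0 := le_rfl
  xiIotaRII0 := le_rfl
  xiIotaDeltaEi := le_add_of_nonneg_right (add_nonneg (total_nonneg hΦ hI _) (total_nonneg hΦ hI _))
  xiIotaOddDeltaEi := le_add_of_nonneg_right (total_nonneg hΦ hI _)
  xiIotaEvenDeltaEi := le_add_of_nonneg_right (total_nonneg hΦ hI _)
  xiIotaEvenTailDeltaEi := le_add_of_nonneg_right (total_nonneg hΦ hI _)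
  xiIotaDeltaZero := le_add_of_nonneg_right (add_nonneg (total_nonneg hΦ hI _) (total_nonneg hΦ hI _))
  xiIotaOddDeltaZero := le_add_of_nonneg_right (total_nonneg hΦ hI _)
  xiIotaEvenDeltaZero := le_add_of_nonneg_right (total_nonneg hΦ hI _)
  xiIotaEvenTailDeltaZero := le_add_of_nonneg_right (total_nonneg hΦ hI _)
  xiIotaRI0DeltaEi := le_rfl
  xiIotaRII0DeltaZero := le_rfl

/-- `inpT Φ ≤ inpT Ψ` for comparable readings. [folklore] -/
theorem inpT_dom_inpT {Φ Ψ : Pt → Reading (Fin 3)} (h : (Φ s).LEAt (Ψ s) (ingr D s y).B (ingr D s y).Bb)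
    (hI : (ingr D s y).Nonneg) : (inpT Φ D y s).Dom (inpT Ψ D y s) where
  mu := le_rfl
  muMin := le_rfl
  mubOverMu := le_rfl
  mub := le_rfl
  xiAlphaOneMinusZeroAtZero := le_rfl
  xiAlphaZeroMinusOneAtZero := le_rfl
  xiAlphaOneMinusZeroAtEi := le_rfl
  xiAlphaZeroMinusOneAtEi := le_rfl
  xiIotaAlphaIAtEi := le_rfl
  xiIotaAlphaIIAtZero := le_rfl
  xiIotaAlphaISumAroundEi := le_rfl
  xiIotaAlphaIISumAroundZero := le_rfl
  psiAlphaIOneMinusZeroAroundEi := le_rfl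
  psiAlphaIIZeroMinusOneAroundZero := le_rfl
  psiAlphaIZeroMinusOneAroundEi := le_rfl
  psiAlphaIIOneMinusZeroAroundZero := le_rfl
  piAlpha := le_rfl
  piAlphaLower := le_rfl
  piOneLower := le_rfl
  psiZeroLower := le_rfl
  xiAbs := add_le_add le_rfl (add_le_add (total_mono h hI _) (total_mono h hI _))
  xiOdd := add_le_add le_rfl (total_mono h hI _)
  xiEven := add_le_add le_rfl (total_mono h hI _)
  xiEvenTail := add_le_add le_rfl (total_mono h hI _)
  xiOddTail := add_le_add le_rfl (total_mono h hI _)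
  xiR0 := le_rfl
  xiR1 := le_rfl
  xiR0Delta := le_rfl
  xiR1Delta := le_rfl
  xiDeltaAbs := add_le_add le_rfl (add_le_add (total_mono h hI _) (total_mono h hI _))
  xiOddDelta := add_le_add le_rfl (total_mono h hI _)
  xiEvenDelta := add_le_add le_rfl (total_mono h hI _)
  xiOddTailDelta := add_le_add le_rfl (total_mono h hI _)
  xiEvenTailDelta := add_le_add le_rfl (total_mono h hI _)
  psiRI0 := le_rfl
  psiRI1 := le_rfl
  psiRII0 := le_rfl
  psiRII1 := le_rfl
  psiRI0Delta := le_rfl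
  psiRI1Delta := le_rfl
  psiRII0Delta := le_rfl
  psiRII1Delta := le_rfl
  piR0 := le_rfl
  piR0DeltaEiEk := le_rfl
  xiIotaAbs := add_le_add le_rfl (add_le_add (total_mono h hI _) (total_mono h hI _))
  xiIotaOdd := add_le_add le_rfl (total_mono h hI _)
  xiIotaEven := add_le_add le_rfl (total_mono h hI _)
  xiIotaEvenTail := add_le_add le_rfl (total_mono h hI _)
  xiIotaRI0 := le_rfl
  xiIotaRII0 := le_rfl
  xiIotaDeltaEi := add_le_add le_rfl (add_le_add (total_mono h hI _) (total_mono h hI _))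
  xiIotaOddDeltaEi := add_le_add le_rfl (total_mono h hI _)
  xiIotaEvenDeltaEi := add_le_add le_rfl (total_mono h hI _)
  xiIotaEvenTailDeltaEi := add_le_add le_rfl (total_mono h hI _)
  xiIotaDeltaZero := add_le_add le_rfl (add_le_add (total_mono h hI _) (total_mono h hI _))
  xiIotaOddDeltaZero := add_le_add le_rfl (total_mono h hI _)
  xiIotaEvenDeltaZero := add_le_add le_rfl (total_mono h hI _)
  xiIotaEvenTailDeltaZero := add_le_add le_rfl (total_mono h hI _)
  xiIotaRI0DeltaEi := le_rfl
  xiIotaRII0DeltaZero := le_rfl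

/-- `T″₀ ≤ T`: the tail-free record is below the record with tails in the information order, wherever the cells
are `≥ 0`. [folklore] -/
theorem inp_dom_inpFull (hev : ∀ e, 0 ≤ D.ev s y e) : (D.inp y s).Dom (inpFull D y s) :=
  inp_dom_inpT (Reading.series_nonnegAt _ _) (ingr_nonneg hev)

/-- `T ≤ T̂(S, S̄)`: under the two Neumann certificates at the point `s` the record with tails is below the
closed-form majorant record (and the ten tail series converge there, `ser_le`). [folklore] -/
theorem inpFull_dom_inpMaj (hev : ∀ e, 0 ≤ D.ev s y e) {S Sb : Pt → Matrix (Fin 3) (Fin 3) ℝ}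
    (hS0 : ∀ i j, 0 ≤ S s i j) (hS : (1 - (ingr D s y).B * (ingr D s y).B) * S s = 1)
    (hSb0 : ∀ i j, 0 ≤ Sb s i j) (hSb : (1 - (ingr D s y).Bb * (ingr D s y).Bb) * Sb s = 1) :
    (inpFull D y s).Dom (inpMaj S Sb D y s) :=
  inpT_dom_inpT
    (Reading.series_leAt_closed (ingr_nonneg hev).B (ingr_nonneg hev).Bb hS0 hS hSb0 hSb) (ingr_nonneg hev)

/-- … hence `T″₀ ≤ T̂(S, S̄)` as well. [folklore] -/
theorem inp_dom_inpMaj (hev : ∀ e, 0 ≤ D.ev s y e) {S Sb : Pt → Matrix (Fin 3) (Fin 3) ℝ}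
    (hS0 : ∀ i j, 0 ≤ S s i j) (hS : (1 - (ingr D s y).B * (ingr D s y).B) * S s = 1)
    (hSb0 : ∀ i j, 0 ≤ Sb s i j) (hSb : (1 - (ingr D s y).Bb * (ingr D s y).Bb) * Sb s = 1) :
    (D.inp y s).Dom (inpMaj S Sb D y s) :=
  (inp_dom_inpFull hev).trans (inpFull_dom_inpMaj hev hS0 hS hSb0 hSb)

end Frame

end Stage1Tails
end Literature.Probability.FitznerVanDerHofstad2017
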